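/-
COR-CM (cell pub-hodgecm2, stage 2 of the Hodge ladder): the typing gap G-T (`HOME/CHAIN-MAP.md` §A0, binder B01 of
`HOME/BINDER-OWNERS.md`) as a kernel object.  Seat prover-pub-hodgecm2-b14 (gen 7), 2026-08-20.  Sequel of
`CorCM/Geometry/NonVacuity.lean` and `CorCM/Geometry/PeriodFreeShadow.lean` (same seat, gen 4).
-/
import Summits.HodgeConjecture.CorCM.Geometry.Facts
import Summits.HodgeConjecture.CorCM.Geometry.NonVacuity
import Literature.AlgebraicGeometry.Motives.HodgeStructureNonempty
import Mathlib.RingTheory.TensorProduct.Free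
import Mathlib.Algebra.Algebra.Bilinear
import HarnessLib

/-!
# The PerL shadow: a universe on which `PerL` and `PerL44` HOLD and `PeriodThmF` FAILS

The stage-2 interface file `CorCM/Interfaces.lean` records two targets over the model universe: the literal one
`HC_CM_of_PerL` (hypothesis = stage 1's sextic statement `Universe.PerL`) and the working one `HC_CM_of_PerLFace`
(hypothesis = the face form `Universe.PeriodThmF`), with binder B01 `PerLFace_of_PerL` between them, and states in
prose (TYPING FINDING, gap G-T) that "`U.PerL → U.PeriodThmF` is NOT a formal consequence".  This file proves that
sentence: the implication fails on an explicit universe, so B01 — a statement about ONE universe, the model — can only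
be discharged by an argument that uses the model, never by a universe-level lemma `∀ U, U.PerL → U.PeriodThmF`
(with or without the hypothesis `PerL44`).

## The construction (`Universe.perLShadow U`)

Start from ANY universe `U` and keep its CM side verbatim (varieties `Sum.inl X`, their cohomology, Hodge structures,
algebraic classes, morphisms, products, `cmAV`, `cmAct` — so `alphaLine`, `eigenLine` are those of `U`).  Add two
synthetic "surfaces" `Sum.inr true`, `Sum.inr false` with cohomology `ℚ × ℚ` in every degree, cup product the
componentwise multiplication and trace the first coordinate; a "morphism" from a synthetic surface to a variety `Y` of
`U` is an arbitrary `ℚ`-linear map `H¹(Y, ℚ) → ℚ × ℚ`, which IS its own pull-back in degree one on `Sum.inr true`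
and pulls back to ZERO on `Sum.inr false`.  The Picard modular surface of `(L, ι₁, V, Γ)` is `Sum.inr true` when
`[L:ℚ] ∈ {24, 48}` and `Sum.inr false` otherwise.  Nothing is claimed about the model facts `Universe.Fact_…` on the
shadow (most of them fail there); the shadow is a separating structure for the two Prop-valued DEFINITIONS `PerL`,
`PeriodThmF`, nothing more.

## Results

* `Universe.perLShadow_perL44`, `Universe.perLShadow_perL`: if `U` satisfies the two CM-type facts M13
  `Fact_eigenLine` and M14 `Fact_alphaLine` (every eigen-line `H¹(A_{(K,Φ)}, ℂ)_σ` is a line, and it is holomorphic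
  for `σ ∈ Φ`), then `PerL44` and `PerL` HOLD on `U.perLShadow`: PerL's surface field `L` has degree `24` or `48`, the
  sign table puts `φ₁` in all four types `tⁱ`, so nonzero holomorphic `φ₁`-eigen one-forms `α_i` exist on the
  `B_{tⁱ}` of `U`; a rational linear form detecting `α_i ≠ 0` (`exists_dual_baseChange_ne_zero`) is a "morphism" whose
  pull-back of `α_i` is `c_i ⊗ (1,0)` with `c_i ≠ 0`, and the period is `c₁ c₂ conj(c₃) conj(c₄) ≠ 0`
  (`perLShadow_period_inr`).
* `Universe.perLShadow_not_periodThmF`: `PeriodThmF` FAILS on `U.perLShadow` for every `U` (no hypothesis): its binder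
  prefix is inhabited at `F = ℚ(ζ₇)` (`[F:ℚ] = 6 ∉ {24, 48}`, `NonVacuity.lean`), whose Picard modular surfaces are
  `Sum.inr false`, where every pulled-back class and hence every period vanishes.
* `Universe.exists_perL_and_not_periodThmF`, `Universe.not_forall_perL_imp_periodThmF`,
  `Universe.not_forall_perL44_imp_periodThmF`: hence, relative to any universe with M13 + M14 (e.g. the model universe
  of record, `CorCM/Model/PerLConeFacts.lean` `Model.universeOf_fact_eigenLine` / `…_alphaLine`), there is a universe with
  `PerL ∧ PerL44 ∧ ¬ PeriodThmF`, and neither `∀ U, U.PerL → U.PeriodThmF` nor `∀ U, U.PerL44 → U.PeriodThmF` holds.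

What this does NOT say: nothing about B01 itself (`PerLFace_of_PerL` quantifies over the model universe only), and
nothing about `PerL` on the model universe.  The separating mechanism is the one named in the TYPING FINDING: `PerL`'s
surfaces live over a field of degree `24`/`48`, `PeriodThmF`'s over the same Galois field as their targets.
-/

noncomputable section

open scoped TensorProduct
open NumberField

namespace Summit.HodgeConjecture.CorCM

open Literature.AlgebraicGeometry.Motives (CMType HodgeStructure)
open Literature.AlgebraicGeometry.Motives
open Literature.NumberTheory.Automorphic

/-! ### Linear algebra: rational linear forms detect nonzero vectors of `ℂ ⊗_ℚ W` -/

/-- A nonzero vector of `ℂ ⊗_ℚ W` (`W` a finite-dimensional `ℚ`-space) is detected by some rational linear form: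
its coordinates in the complexification of a rational basis are the values of the complexified coordinate forms. -/
theorem exists_dual_baseChange_ne_zero {W : Type*} [AddCommGroup W] [Module ℚ W] [Module.Finite ℚ W]
    {x : ℂ ⊗[ℚ] W} (hx : x ≠ 0) : ∃ g : W →ₗ[ℚ] ℚ, g.baseChange ℂ x ≠ 0 := by
  classical
  by_contra! h
  apply hx
  let b := Module.Free.chooseBasis ℚ W
  let B := Algebra.TensorProduct.basis ℂ b
  have key : ∀ (y : ℂ ⊗[ℚ] W) (i : Module.Free.ChooseBasisIndex ℚ W),
      B.repr y i = TensorProduct.AlgebraTensorModule.rid ℚ ℂ ℂ ((b.coord i).baseChange ℂ y) := by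
    intro y i
    induction y using TensorProduct.induction_on with
    | zero => simp
    | tmul c w =>
        simp only [B, Algebra.TensorProduct.basis_repr_tmul, Finsupp.smul_apply, Finsupp.mapRange_apply,
          LinearMap.baseChange_tmul, Module.Basis.coord_apply, TensorProduct.AlgebraTensorModule.rid_tmul,
          smul_eq_mul, Algebra.smul_def, mul_comm c]
    | add y z hy hz => simp only [map_add, Finsupp.add_apply, hy, hz]
  refine B.ext_elem fun i => ?_
  rw [key, h, map_zero, map_zero, Finsupp.zero_apply]

namespace Universe

variable (U : Universe)

/-! ### The carriers, morphisms and products of the shadow -/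

/-- Cohomology carriers of the shadow: those of `U` on `U`'s varieties, `ℚ × ℚ` in every degree on the two synthetic
surfaces. -/
@[reducible] def shadowCoh : U.Var ⊕ Bool → ℕ → Type
  | .inl X, k => U.Coh X k
  | .inr _, _ => ℚ × ℚ

/-- The carriers are abelian groups (those of `U`, resp. `ℚ × ℚ`). -/
instance shadowCoh.instAddCommGroup : ∀ (X : U.Var ⊕ Bool) (k : ℕ), AddCommGroup (U.shadowCoh X k)
  | .inl X, k => inferInstanceAs (AddCommGroup (U.Coh X k))
  | .inr _, _ => inferInstanceAs (AddCommGroup (ℚ × ℚ))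

/-- The carriers are `ℚ`-vector spaces (those of `U`, resp. `ℚ × ℚ`). -/
instance shadowCoh.instModule : ∀ (X : U.Var ⊕ Bool) (k : ℕ), Module ℚ (U.shadowCoh X k)
  | .inl X, k => inferInstanceAs (Module ℚ (U.Coh X k))
  | .inr _, _ => inferInstanceAs (Module ℚ (ℚ × ℚ))

/-- The carriers are finite-dimensional (those of `U`, resp. `ℚ × ℚ`). -/
instance shadowCoh.instFinite : ∀ (X : U.Var ⊕ Bool) (k : ℕ), Module.Finite ℚ (U.shadowCoh X k)
  | .inl X, k => inferInstanceAs (Module.Finite ℚ (U.Coh X k))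
  | .inr _, _ => inferInstanceAs (Module.Finite ℚ (ℚ × ℚ))

/-- Morphisms of the shadow: those of `U` between `U`'s varieties; from a synthetic surface to a variety `Y` of `U`,
ANY `ℚ`-linear map `H¹(Y, ℚ) → ℚ × ℚ` (it will be its own degree-one pull-back); none from a variety of `U` to a
synthetic surface; a point between synthetic surfaces. -/
@[reducible] def shadowMor : U.Var ⊕ Bool → U.Var ⊕ Bool → Type
  | .inl X, .inl Y => U.Mor X Y
  | .inr _, .inl Y => U.Coh Y 1 →ₗ[ℚ] ℚ × ℚ
  | .inl _, .inr _ => PEmpty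
  | .inr _, .inr _ => PUnit

/-- Identity morphisms of the shadow. -/
def shadowId : ∀ X : U.Var ⊕ Bool, U.shadowMor X X
  | .inl X => U.idMor X
  | .inr _ => PUnit.unit

/-- Composition of morphisms of the shadow (diagrammatic order, as `Universe.comp`): `U`'s composition, and
precomposition of a linear map `H¹(Y) → ℚ × ℚ` with the pull-back `H¹(Z) → H¹(Y)` of a morphism `Y → Z` of `U`. -/
def shadowComp : ∀ {X Y Z : U.Var ⊕ Bool}, U.shadowMor X Y → U.shadowMor Y Z → U.shadowMor X Z
  | .inl _, .inl _, .inl _, f, g => U.comp f g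
  | .inr _, .inl _, .inl _, f, g => f ∘ₗ U.pull g 1
  | .inr _, .inr _, .inl _, _, g => g
  | .inl _, .inr _, _, f, _ => PEmpty.elim f
  | .inl _, .inl _, .inr _, _, g => PEmpty.elim g
  | .inr _, .inl _, .inr _, _, g => PEmpty.elim g
  | .inr _, .inr _, .inr _, _, _ => PUnit.unit

/-- Pull-backs of the shadow: those of `U`; a "morphism" `f : H¹(Y, ℚ) → ℚ × ℚ` out of the synthetic surface
`Sum.inr true` pulls back BY `f` in degree one and by zero in the other degrees; everything pulls back to zero on
`Sum.inr false`; identities between the synthetic surfaces. -/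
def shadowPull : ∀ {X Y : U.Var ⊕ Bool}, U.shadowMor X Y → ∀ k : ℕ, U.shadowCoh Y k →ₗ[ℚ] U.shadowCoh X k
  | .inl _, .inl _, f, k => U.pull f k
  | .inr true, .inl _, f, 1 => f
  | .inr true, .inl _, _, 0 => 0
  | .inr true, .inl _, _, (_ + 2) => 0
  | .inr false, .inl _, _, _ => 0
  | .inl _, .inr _, f, _ => PEmpty.elim f
  | .inr _, .inr _, _, _ => LinearMap.id

/-- Products of the shadow: those of `U`; every product involving a synthetic surface is `Sum.inr false`. -/
def shadowProd : U.Var ⊕ Bool → U.Var ⊕ Bool → U.Var ⊕ Bool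
  | .inl X, .inl Y => .inl (U.prod X Y)
  | .inl _, .inr _ => .inr false
  | .inr _, _ => .inr false

/-- First projections of the shadow (those of `U`; zero maps / points otherwise). -/
def shadowFst : ∀ X Y : U.Var ⊕ Bool, U.shadowMor (U.shadowProd X Y) X
  | .inl X, .inl Y => U.fst X Y
  | .inl X, .inr _ => (0 : U.Coh X 1 →ₗ[ℚ] ℚ × ℚ)
  | .inr _, .inl _ => PUnit.unit
  | .inr _, .inr _ => PUnit.unit

/-- Second projections of the shadow (those of `U`; zero maps / points otherwise). -/
def shadowSnd : ∀ X Y : U.Var ⊕ Bool, U.shadowMor (U.shadowProd X Y) Y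
  | .inl X, .inl Y => U.snd X Y
  | .inl _, .inr _ => PUnit.unit
  | .inr _, .inl Y => (0 : U.Coh Y 1 →ₗ[ℚ] ℚ × ℚ)
  | .inr _, .inr _ => PUnit.unit

/-! ### The shadow universe -/

/-- **The PerL shadow of `U`.** Varieties `U.Var ⊕ Bool`: `U`'s varieties with all their structure (cohomology, Hodge
structures, algebraic classes, morphisms, products, CM abelian varieties `cmAV K Φ := inl (U.cmAV K Φ)` with `U`'s CM
action), plus two synthetic surfaces `inr b` with `H^k = ℚ × ℚ`, cup product the componentwise multiplication, trace
the first coordinate, some Hodge structure (`HodgeStructure.instNonemptyProdSelf`), no algebraic classes.  The Picard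
modular surface `P_Γ` of `(L, ι₁, V, Γ)` is `inr true` if `[L:ℚ] ∈ {24, 48}` and `inr false` otherwise. -/
def perLShadow : Universe where
  Var := U.Var ⊕ Bool
  dim X := match X with
    | .inl X => U.dim X
    | .inr _ => 2
  Coh := U.shadowCoh
  instAddCommGroup := shadowCoh.instAddCommGroup U
  instModule := shadowCoh.instModule U
  instFinite := shadowCoh.instFinite U
  hodge X k := match X with
    | .inl X => U.hodge X k
    | .inr _ => (HodgeStructure.instNonemptyProdSelf (V := ℚ) (k : ℤ)).some
  alg X p := match X with
    | .inl X => U.alg X p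
    | .inr _ => ⊥
  Mor := U.shadowMor
  idMor := U.shadowId
  comp f g := U.shadowComp f g
  pull f k := U.shadowPull f k
  cup X i j := match X with
    | .inl X => U.cup X i j
    | .inr _ => LinearMap.mul ℚ (ℚ × ℚ)
  tr X k := match X with
    | .inl X => U.tr X k
    | .inr _ => LinearMap.fst ℚ ℚ ℚ
  prod := U.shadowProd
  fst := U.shadowFst
  snd := U.shadowSnd
  IsAbelianVariety X := match X with
    | .inl X => U.IsAbelianVariety X
    | .inr _ => False
  IsCMAbelianVariety X := match X with
    | .inl X => U.IsCMAbelianVariety X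
    | .inr _ => False
  cmAV K Φ := .inl (U.cmAV K Φ)
  cmAct K Φ := U.cmAct K Φ
  pms L _ _ _ := .inr (decide (Module.finrank ℚ L = 24 ∨ Module.finrank ℚ L = 48))

/-! ### Computations on the shadow -/

/-- The holomorphic eigen-lines of the shadow are those of `U` (same carrier, same Hodge structure, same CM action). -/
theorem perLShadow_alphaLine (K : CMField) (Φ : CMType K) (σ : K →+* ℂ) :
    U.perLShadow.alphaLine K Φ σ = U.alphaLine K Φ σ := rfl

/-- The Picard modular surfaces over a field of degree `24` or `48` are the synthetic surface `inr true`. -/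
theorem perLShadow_pms_of_finrank {L : CMField} (hL : Module.finrank ℚ L = 24 ∨ Module.finrank ℚ L = 48)
    (ι₁ : L →+* ℂ) (V : HermSpace3 L ι₁) (Γ : Level V) : U.perLShadow.pms L ι₁ V Γ = .inr true := by
  show Sum.inr (decide _) = _
  rw [decide_eq_true hL]

/-- The Picard modular surfaces over a field of degree `∉ {24, 48}` are the synthetic surface `inr false`. -/
theorem perLShadow_pms_of_not_finrank {L : CMField} (hL : ¬ (Module.finrank ℚ L = 24 ∨ Module.finrank ℚ L = 48))
    (ι₁ : L →+* ℂ) (V : HermSpace3 L ι₁) (Γ : Level V) : U.perLShadow.pms L ι₁ V Γ = .inr false := by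
  show Sum.inr (decide _) = _
  rw [decide_eq_false hL]

/-- On `inr false`, every class pulls back to zero in degree one. -/
theorem perLShadow_pullC_inr_false {Y : U.Var} (f : U.Coh Y 1 →ₗ[ℚ] ℚ × ℚ) (α : U.CohC Y 1) :
    U.perLShadow.pullC (X := .inr false) (Y := .inl Y) f 1 α = 0 := by
  show ((0 : U.Coh Y 1 →ₗ[ℚ] ℚ × ℚ).baseChange ℂ) α = 0
  rw [LinearMap.baseChange_zero, LinearMap.zero_apply]

/-- **The period on a synthetic surface**: for classes `c_i ⊗ (1,0)` the quadrilinear period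
`tr((ω₁ ∪ ω₂) ∪ (conj ω₃ ∪ conj ω₄))` is `c₁ c₂ conj(c₃) conj(c₄)`. -/
theorem perLShadow_period_inr (b : Bool) (c : Fin 4 → ℂ) :
    U.perLShadow.period (.inr b) (fun i => c i ⊗ₜ[ℚ] ((1, 0) : ℚ × ℚ)) =
      c 0 * c 1 * (starRingEnd ℂ (c 2) * starRingEnd ℂ (c 3)) := by
  show TensorProduct.AlgebraTensorModule.rid ℚ ℂ ℂ ((LinearMap.fst ℚ ℚ ℚ).baseChange ℂ
      (LinearMap.BilinMap.baseChange ℂ (LinearMap.mul ℚ (ℚ × ℚ))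
        (LinearMap.BilinMap.baseChange ℂ (LinearMap.mul ℚ (ℚ × ℚ))
          (c 0 ⊗ₜ[ℚ] ((1, 0) : ℚ × ℚ)) (c 1 ⊗ₜ[ℚ] ((1, 0) : ℚ × ℚ)))
        (LinearMap.BilinMap.baseChange ℂ (LinearMap.mul ℚ (ℚ × ℚ))
          (HodgeStructure.conj (c 2 ⊗ₜ[ℚ] ((1, 0) : ℚ × ℚ)))
          (HodgeStructure.conj (c 3 ⊗ₜ[ℚ] ((1, 0) : ℚ × ℚ)))))) = _
  simp only [HodgeStructure.conj_tmul, LinearMap.BilinMap.baseChange_tmul, LinearMap.mul_apply',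
    Prod.mk_mul_mk, mul_one, mul_zero, LinearMap.baseChange_tmul, LinearMap.fst_apply,
    TensorProduct.AlgebraTensorModule.rid_tmul, one_smul]

/-- On `inr false` every quadrilinear period of pulled-back degree-one classes vanishes. -/
theorem perLShadow_period_inr_false (K : CMField) (Ψ : Fin 4 → CMType K)
    (F : (i : Fin 4) → U.perLShadow.Mor (.inr false) (U.perLShadow.cmAV K (Ψ i)))
    (α : (i : Fin 4) → U.perLShadow.CohC (U.perLShadow.cmAV K (Ψ i)) 1) :
    U.perLShadow.period (.inr false) (fun i => U.perLShadow.pullC (F i) 1 (α i)) = 0 := by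
  have h0 : (fun i => U.perLShadow.pullC (F i) 1 (α i)) = fun _ => 0 :=
    funext fun i => U.perLShadow_pullC_inr_false (F i) (α i)
  rw [h0]
  show U.perLShadow.trC (.inr false) 4 (U.perLShadow.cup2C (.inr false) 2
    (U.perLShadow.cup2C (.inr false) 1 0 0)
    (U.perLShadow.cup2C (.inr false) 1 (HodgeStructure.conj 0) (HodgeStructure.conj 0))) = 0
  simp only [map_zero]

/-! ### `PerL44` and `PerL` hold on the shadow -/

/-- **Core of the separation.** On the synthetic surface `inr true`, for every CM field `K`, types `Ψ_i` and an
embedding `σ` lying in all four types, there are "morphisms" `F_i` to the `A_{(K,Ψ_i)}` of `U` and holomorphic `σ`-eigen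
one-forms `α_i` with NONZERO period — provided `U` satisfies M13 `Fact_eigenLine` and M14 `Fact_alphaLine`. -/
theorem perLShadow_exists_period_ne_zero (hE : U.Fact_eigenLine) (hA : U.Fact_alphaLine)
    (K : CMField) (Ψ : Fin 4 → CMType K) (σ : K →+* ℂ) (hσ : ∀ i, σ ∈ (Ψ i).1)
    (X : U.perLShadow.Var) (hX : X = .inr true) :
    ∃ (F : (i : Fin 4) → U.perLShadow.Mor X (U.perLShadow.cmAV K (Ψ i)))
      (α : (i : Fin 4) → U.perLShadow.CohC (U.perLShadow.cmAV K (Ψ i)) 1),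
      (∀ i, α i ∈ U.perLShadow.alphaLine K (Ψ i) σ) ∧
        U.perLShadow.period X (fun i => U.perLShadow.pullC (F i) 1 (α i)) ≠ 0 := by
  subst hX
  -- nonzero holomorphic `σ`-eigen one-forms on the `A_{(K,Ψ_i)}` of `U`
  have hne : ∀ i, ∃ v ∈ U.alphaLine K (Ψ i) σ, v ≠ 0 := fun i => by
    rw [(hA K (Ψ i) σ).1 (hσ i)]
    have h1 : 0 < Module.finrank ℂ (U.eigenLine K (Ψ i) σ) := by rw [hE K (Ψ i) σ]; exact Nat.one_pos
    obtain ⟨⟨v, hv⟩, hv0⟩ := Module.finrank_pos_iff_exists_ne_zero.1 h1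
    exact ⟨v, hv, fun h => hv0 (Subtype.ext h)⟩
  choose α hα hα0 using hne
  -- rational linear forms detecting them
  have hg : ∀ i, ∃ g : U.Coh (U.cmAV K (Ψ i)) 1 →ₗ[ℚ] ℚ, g.baseChange ℂ (α i) ≠ 0 := fun i =>
    exists_dual_baseChange_ne_zero (hα0 i)
  choose g hg using hg
  -- the values `c_i ≠ 0` of the complexified forms
  have hc : ∀ i, ∃ c : ℂ, c ≠ 0 ∧ (g i).baseChange ℂ (α i) = c ⊗ₜ[ℚ] (1 : ℚ) := fun i =>
    ⟨TensorProduct.AlgebraTensorModule.rid ℚ ℂ ℂ ((g i).baseChange ℂ (α i)),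
      fun h => hg i ((LinearEquiv.map_eq_zero_iff _).1 h),
      by rw [← TensorProduct.AlgebraTensorModule.rid_symm_apply (R := ℚ) (A := ℂ) (M := ℂ),
        LinearEquiv.symm_apply_apply]⟩
  choose c hc0 hc using hc
  refine ⟨fun i => (LinearMap.inl ℚ ℚ ℚ ∘ₗ g i : U.Coh (U.cmAV K (Ψ i)) 1 →ₗ[ℚ] ℚ × ℚ), α, hα, ?_⟩
  have hω : ∀ i, U.perLShadow.pullC (X := .inr true) (Y := U.perLShadow.cmAV K (Ψ i))
      (LinearMap.inl ℚ ℚ ℚ ∘ₗ g i) 1 (α i) = c i ⊗ₜ[ℚ] ((1, 0) : ℚ × ℚ) := fun i => by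
    show ((LinearMap.inl ℚ ℚ ℚ ∘ₗ g i).baseChange ℂ) (α i) = _
    rw [LinearMap.baseChange_comp, LinearMap.comp_apply, hc, LinearMap.baseChange_tmul, LinearMap.inl_apply]
  simp only [hω]
  refine ne_of_eq_of_ne (U.perLShadow_period_inr true c) ?_
  exact mul_ne_zero (mul_ne_zero (hc0 0) (hc0 1))
    (mul_ne_zero ((map_ne_zero _).2 (hc0 2)) ((map_ne_zero _).2 (hc0 3)))

/-- **`PeriodNV` holds on the shadow** for every surface field `L` of degree `24` or `48`, every hermitian space, every
CM field `K`, all types `Ψ_i` and every `σ` lying in all of them (given M13 + M14 on `U`). -/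
theorem perLShadow_periodNV (hE : U.Fact_eigenLine) (hA : U.Fact_alphaLine) {L : CMField}
    (hL : Module.finrank ℚ L = 24 ∨ Module.finrank ℚ L = 48) (ι₁ : L →+* ℂ) (V : HermSpace3 L ι₁)
    (K : CMField) (Ψ : Fin 4 → CMType K) (σ : K →+* ℂ) (hσ : ∀ i, σ ∈ (Ψ i).1) :
    U.perLShadow.PeriodNV ι₁ V K Ψ σ := by
  obtain ⟨Γ⟩ := Level.nonempty V
  obtain ⟨F, α, hα, hP⟩ := U.perLShadow_exists_period_ne_zero hE hA K Ψ σ hσ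
    (U.perLShadow.pms L ι₁ V Γ) (U.perLShadow_pms_of_finrank hL ι₁ V Γ)
  exact ⟨Γ, F, α, hα, hP⟩

/-- PerL's sign table puts the first frame embedding `φ₁` in all four types `t¹,…,t⁴`. -/
theorem mem_of_isPerLTypes {K : Type} [Field K] {φ : Fin 3 → (K →+* ℂ)} {t : Fin 4 → CMType K}
    (ht : IsPerLTypes φ t) (i : Fin 4) : φ 0 ∈ (t i).1 :=
  (ht i 0).2 (by fin_cases i <;> rfl)

/-- **PerL Thm 4.4 (`PerL44`, `∀ V` form) HOLDS on the shadow** of any universe with M13 + M14. -/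
theorem perLShadow_perL44 (hE : U.Fact_eigenLine) (hA : U.Fact_alphaLine) : U.perLShadow.PerL44 :=
  fun K _L _j _ _hK hL φ _hφ ι₁ _hι t ht V =>
    U.perLShadow_periodNV hE hA hL ι₁ V K t (φ 0) (mem_of_isPerLTypes ht)

/-- **PerL (`W_per^L`, `∃ V` form) HOLDS on the shadow** of any universe with M13 + M14 (a hermitian space of the
required signature exists by Landherr, `landherr_exists_proof`). -/
theorem perLShadow_perL (hE : U.Fact_eigenLine) (hA : U.Fact_alphaLine) : U.perLShadow.PerL :=
  fun K L j hN hK hL φ hφ ι₁ hι t ht =>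
    let ⟨V⟩ := landherr_exists_proof L ι₁
    ⟨V, U.perLShadow_perL44 hE hA K L j hN hK hL φ hφ ι₁ hι t ht V⟩

/-! ### `PeriodThmF` fails on the shadow -/

/-- Over a surface field of degree `∉ {24, 48}` no period datum of the shadow has a nonzero period. -/
theorem perLShadow_not_periodNV {L : CMField} (hL : ¬ (Module.finrank ℚ L = 24 ∨ Module.finrank ℚ L = 48))
    (ι₁ : L →+* ℂ) (V : HermSpace3 L ι₁) (K : CMField) (Ψ : Fin 4 → CMType K) (σ : K →+* ℂ) :
    ¬ U.perLShadow.PeriodNV ι₁ V K Ψ σ := by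
  rintro ⟨Γ, F, α, -, hP⟩
  apply hP
  have key : ∀ (X : U.perLShadow.Var), X = .inr false →
      ∀ (F : (i : Fin 4) → U.perLShadow.Mor X (U.perLShadow.cmAV K (Ψ i)))
        (α : (i : Fin 4) → U.perLShadow.CohC (U.perLShadow.cmAV K (Ψ i)) 1),
        U.perLShadow.period X (fun i => U.perLShadow.pullC (F i) 1 (α i)) = 0 := by
    rintro X rfl F α
    exact U.perLShadow_period_inr_false K Ψ F α
  exact key _ (U.perLShadow_pms_of_not_finrank hL ι₁ V Γ) F α

/-- **The face-form period theorem `PeriodThmF` FAILS on the shadow** (of every universe, unconditionally): its binder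
prefix is inhabited at the Galois CM field `ℚ(ζ₇)` of degree `6 ∉ {24, 48}` (a face, an admissible embedding, a
hermitian space: `NonVacuity.lean`), and there every period vanishes. -/
theorem perLShadow_not_periodThmF : ¬ U.perLShadow.PeriodThmF := by
  intro h
  let F : CMField := ⟨CyclotomicField.{0} 7 ℚ⟩
  have hG : IsGalois ℚ F := isGalois_cyclotomicField_seven
  have h6 : Module.finrank ℚ F = 6 := UnitaryGroup.finrank_cyclotomicField_seven
  obtain ⟨f, ι₁, hf⟩ := exists_face_admissible F h6.ge
  obtain ⟨V⟩ := landherr_exists_proof F ι₁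
  exact U.perLShadow_not_periodNV (by omega) ι₁ V F f.psi ι₁ (h F hG h6.ge f ι₁ hf V)

/-! ### The separation statements -/

/-- **`PerL ∧ PerL44 ∧ ¬ PeriodThmF` is satisfiable** relative to any universe with the CM-type facts M13 + M14:
its PerL shadow is a witness. -/
theorem exists_perL_and_not_periodThmF (hE : U.Fact_eigenLine) (hA : U.Fact_alphaLine) :
    ∃ U' : Universe, U'.PerL ∧ U'.PerL44 ∧ ¬ U'.PeriodThmF :=
  ⟨U.perLShadow, U.perLShadow_perL hE hA, U.perLShadow_perL44 hE hA, U.perLShadow_not_periodThmF⟩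

/-- **Gap G-T as a kernel object**: `PerL → PeriodThmF` is not a universe-level implication.  If
`∀ U, U.PerL → U.PeriodThmF` held, no universe could satisfy the CM-type facts M13 + M14 (which the model universe
of record does: `Model.universeOf_fact_eigenLine`, `Model.universeOf_fact_alphaLine`). -/
theorem not_forall_perL_imp_periodThmF (hE : U.Fact_eigenLine) (hA : U.Fact_alphaLine) :
    ¬ ∀ U' : Universe, U'.PerL → U'.PeriodThmF :=
  fun h => U.perLShadow_not_periodThmF (h _ (U.perLShadow_perL hE hA))

/-- The same for the `∀ V` form: `PerL44 → PeriodThmF` is not a universe-level implication either ("PerL Thm 4.4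
transposed" — the face form — is a different statement, not a formal corollary). -/
theorem not_forall_perL44_imp_periodThmF (hE : U.Fact_eigenLine) (hA : U.Fact_alphaLine) :
    ¬ ∀ U' : Universe, U'.PerL44 → U'.PeriodThmF :=
  fun h => U.perLShadow_not_periodThmF (h _ (U.perLShadow_perL44 hE hA))

end Universe

end Summit.HodgeConjecture.CorCM

end
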